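import Mathlib
import HarnessLib.Audit.Tags
import Summits.Ventures.ResidMod.Conjectures.TwistedTorsionFamilyLaw
import Summits.Ventures.ResidMod.Conjectures.SquareClassImprimitivity
import Summits.Ventures.ResidMod.Conjectures.SquareClassGalois
import Summits.Ventures.ResidMod.Conjectures.ImprimitiveCertificates

/-!
# Imprimitive linkage — the named residual loci ARE block structures (venture `ResidMod`, cell pub-residmod, TODO-29 remainder part 1)

Honest framing: this file types and PROVES elementary algebra about integer sextics; it is bookkeeping for the
OBJECT→THEOREM census cell «pub-residmod» (STRUCTURE.md §4 E38 / §6 TODO-29), not a contribution to the Langlands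
programme, and nothing here is deep. Registered on the cell bus before any proof was written (INBOX R301, lead g13,
2026-08-23); re-proposed once (R303) with the `EVEN` decision section and two docstring corrections after referee g40's
read (g40-A/B, R302).

What rung 23a (STRUCTURE.md E38) established BY COMPUTATION on `210 613` classified-residual members is that the three
named mechanisms of the residual are imprimitivity certificates. This file proves the two inclusions that are pure
algebra, for ALL integer sextics, against the typed notions already in the tree:

* `hasThreeBlocks_of_memberSQ` — the square class `MemberSQ` (rung 19, `4f = G² + c·ℓ⁶`; `SquareClassImprimitivity`,
  p366914) is contained in `HasThreeBlocks` (`ImprimitiveCertificates`, p369982): over `ℚ(√−c)` the norm identity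
  `4f = (G − √−c ℓ³)(G + √−c ℓ³)` (`sqRep_factor_over`, `SquareClassGalois`, p367551) is a cubic-times-cubic splitting
  (when `−c` is a rational square the splitting is already rational and any quadratic field, here `ℚ(√−1)`, will do).
  Corollary `M19_card_dvd_72_of_threeBlocks`: TODO-27's bound `|Gal| ∣ 72` re-derived from the generic 3-block bound.
* `hasTwoBlocks_of_evenAfterShift` — an IRREDUCIBLE sextic that is even after a rational shift (`EvenAfterShift`,
  `f(x) = g((x − t)²)`, the flag `EVEN` / certificate `CUBE` of rungs 20–23a) is in `HasTwoBlocks`: over the cubic field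
  `ℚ[Y]/(g)` with root `θ`, `f = ((x − t)² − θ)·g₁((x − t)²)`. Corollaries: `|Gal| ∣ 144`, never `Typical`, no element
  of order `5`.
* `evenShift_witness_eq`, `evenAfterShift_iff` — the record's flag DECIDES the predicate (referee g40 R-2): the shift
  is forced to `t₀ = −a₅/(6a₆)` (`evenShift`), and `EvenAfterShift f ⇔` every odd coefficient of `f(x + t₀)` vanishes —
  literally the test of `rho22.even_after_shift`; the witness is `g = contract 2 (f(x + t₀))`.
* `not_typical_of_reducible` — mechanism M-20 (the part `RED`): a non-degenerate sextic reducible over `ℚ` has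
  `|Gal| ∣ d!(6−d)! ≤ 120 < 360`, so it is never `Typical`; with `evenAfterShift_not_typical`, `evenAfterShift_not_typical'` covers
  the whole `EVEN` locus with no irreducibility hypothesis.

OWED (TODO-29 remainder part 2, not attempted here): (a) the sharp bound `|Gal(f/ℚ)| ∣ 48 = |C₂ ≀ S₃|` for an
IRREDUCIBLE `f` with `HasTwoBlocks f` (proof shape, referee g40 (3)(a): `[L:ℚ] = 3` is prime and `Gal(f/ℚ)` is
transitive, hence the cubic field `L = ℚ[Y]/(S)` embeds in the splitting field `M` of `f` (`L ⊂ M`); every root of `f` is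
a root of a conjugate of the quadratic factor, so `M` is a tower of ≤ 3 quadratic steps over the Galois closure of `L`,
`[M:ℚ] ∣ 6·8 = 48`). Irreducibility is NECESSARY there: the
product of two cubics with linearly disjoint `S₃` splitting fields satisfies `HasTwoBlocks` (over the cubic field of
the first factor that factor drops a root, leaving a quadratic) and has `|Gal| = 36 ∤ 48`, while a quadratic times an
`S₄`-quartic gives `48 ∤ 36`; `lcm = 144`, so p369982's `144` is SHARP for the irreducibility-free notion as typed.
(b) the rung-23a resultant certificate (`IRRED`: an irreducible cubic factor `S` of `R(s) = Res_x(f(x), f(s − x))` with the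
paired quadratic of degree exactly `2`) ⇒ `HasTwoBlocks` (needs the Galois correspondence / resultant API).

No `sorry`, no new axioms.
-/

open Polynomial Module

namespace Summit.Ventures.ResidMod.Conjectures

/-! ## Transport of the integer sextic to a `ℚ`-algebra -/

/-- Over any field `K` with a `ℚ`-algebra structure, mapping `toRatPoly f` along `algebraMap ℚ K` is mapping `toPoly f`
along the integer cast (the ring morphism `ℤ → K` is unique). -/
theorem toRatPoly_map_eq (K : Type*) [Field K] [Algebra ℚ K] (f : Sextic) :
    (toRatPoly f).map (algebraMap ℚ K) = (toPoly f).map (Int.castRingHom K) := by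
  rw [toRatPoly, Polynomial.map_map,
    Subsingleton.elim ((algebraMap ℚ K).comp (Int.castRingHom ℚ)) (Int.castRingHom K)]

/-! ## Linkage 1 (TODO-29 (ii), first half): the square class has blocks of size 3 -/

/-- From a factorisation `4·f = A·B` over the quadratic field `ℚ[Y]/(Y² − D)` with `deg A, deg B ≤ 3` (hence `= 3`) to
`HasThreeBlocks f`. Stated in the `toPoly`/`Int.castRingHom` form that `sqRep_factor_over` (p367551) produces. -/
theorem hasThreeBlocks_of_split {f : Sextic} {D : ℚ} [hD : Fact (Irreducible (X ^ 2 - C D : ℚ[X]))]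
    {A B : (AdjoinRoot (X ^ 2 - C D : ℚ[X]))[X]}
    (hAB : C (4 : AdjoinRoot (X ^ 2 - C D : ℚ[X])) *
      (toPoly f).map (Int.castRingHom (AdjoinRoot (X ^ 2 - C D : ℚ[X]))) = A * B)
    (hA : A.natDegree ≤ 3) (hB : B.natDegree ≤ 3)
    (h6 : ((toPoly f).map (Int.castRingHom (AdjoinRoot (X ^ 2 - C D : ℚ[X])))).natDegree = 6) :
    HasThreeBlocks f := by
  have h4 : (4 : AdjoinRoot (X ^ 2 - C D : ℚ[X])) ≠ 0 := by
    haveI : CharZero (AdjoinRoot (X ^ 2 - C D : ℚ[X])) :=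
      charZero_of_injective_algebraMap (algebraMap ℚ (AdjoinRoot (X ^ 2 - C D : ℚ[X]))).injective
    norm_num
  have hF0 : (toPoly f).map (Int.castRingHom (AdjoinRoot (X ^ 2 - C D : ℚ[X]))) ≠ 0 := by
    intro h0
    rw [h0, natDegree_zero] at h6
    omega
  have hAB0 : A * B ≠ 0 := by
    rw [← hAB]
    exact mul_ne_zero (by rwa [Ne, C_eq_zero]) hF0
  have hsum : A.natDegree + B.natDegree = 6 := by
    rw [← natDegree_mul (left_ne_zero_of_mul hAB0) (right_ne_zero_of_mul hAB0), ← hAB,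
      natDegree_C_mul h4, h6]
  have hA3 : A.natDegree = 3 := by omega
  have hq3 : (C (4 : AdjoinRoot (X ^ 2 - C D : ℚ[X]))⁻¹ * A).natDegree = 3 := by
    rw [natDegree_C_mul (inv_ne_zero h4), hA3]
  have e : (toRatPoly f).map (algebraMap ℚ (AdjoinRoot (X ^ 2 - C D : ℚ[X]))) =
      (toPoly f).map (Int.castRingHom (AdjoinRoot (X ^ 2 - C D : ℚ[X]))) := toRatPoly_map_eq _ f
  have hfin : (toRatPoly f).map (algebraMap ℚ (AdjoinRoot (X ^ 2 - C D : ℚ[X]))) =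
      C (4 : AdjoinRoot (X ^ 2 - C D : ℚ[X]))⁻¹ * A * B := by
    rw [e, mul_assoc, ← hAB, ← mul_assoc, ← C_mul, inv_mul_cancel₀ h4, C_1, one_mul]
  unfold HasThreeBlocks
  exact ⟨D, hD.out, C (4 : AdjoinRoot (X ^ 2 - C D : ℚ[X]))⁻¹ * A, B, hq3, hfin⟩

/-- `Y² + 1` is irreducible over `ℚ`. -/
theorem irreducible_X_sq_add_one : Irreducible (X ^ 2 - C (-1 : ℚ) : ℚ[X]) := by
  refine X_pow_sub_C_irreducible_of_prime Nat.prime_two ?_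
  intro b hb
  have h0 : (0 : ℚ) ≤ b ^ 2 := sq_nonneg b
  rw [hb] at h0
  norm_num at h0

/-- **PROVED (TODO-29 linkage, square class ⊆ 3-blocks).** A square-class sextic (`4f = G² + c·ℓ⁶`, `deg G ≤ 3`,
`deg ℓ ≤ 1`) with `f 6 ≠ 0` has blocks of size `3`: if `−c` is not a rational square, over `ℚ(√−c) = ℚ[Y]/(Y² + c)` one
has `4f = (G − √−c·ℓ³)(G + √−c·ℓ³)` (`sqRep_factor_over`, p367551), a cubic times a cubic; if `−c = b²` with `b ∈ ℚ`
the same identity already holds over `ℚ`, hence over every quadratic field — the proof uses `ℚ(√−1)`. So the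
mechanism `M-19` of rung 19 is literally the case `D = −c` of `HasThreeBlocks` (rung 23a's «quadratic-norm splitting»,
STRUCTURE.md §4 E38). -/
theorem hasThreeBlocks_of_memberSQ {f : Sextic} (hf : f 6 ≠ 0) (h : MemberSQ f) : HasThreeBlocks f := by
  classical
  obtain ⟨c, G, ℓ, -, -, hG, hℓ1, hrep⟩ := h
  by_cases hsq : ∃ b : ℚ, b ^ 2 = -(c : ℚ)
  · -- `−c` is a rational square: the two cubics are rational; any quadratic field works, take `D = −1`
    obtain ⟨b, hb⟩ := hsq
    haveI : Fact (Irreducible (X ^ 2 - C (-1 : ℚ) : ℚ[X])) := ⟨irreducible_X_sq_add_one⟩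
    have hcz : CharZero (AdjoinRoot (X ^ 2 - C (-1 : ℚ) : ℚ[X])) :=
      charZero_of_injective_algebraMap (algebraMap ℚ (AdjoinRoot (X ^ 2 - C (-1 : ℚ) : ℚ[X]))).injective
    have hs : (AdjoinRoot.of (X ^ 2 - C (-1 : ℚ) : ℚ[X]) b) ^ 2 =
        -(c : AdjoinRoot (X ^ 2 - C (-1 : ℚ) : ℚ[X])) := by
      rw [← map_pow (AdjoinRoot.of (X ^ 2 - C (-1 : ℚ) : ℚ[X])) b 2, hb,
        (AdjoinRoot.of (X ^ 2 - C (-1 : ℚ) : ℚ[X])).map_neg (c : ℚ),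
        map_intCast (AdjoinRoot.of (X ^ 2 - C (-1 : ℚ) : ℚ[X])) c]
    obtain ⟨A, B, hAB, hA, hB, h6⟩ := @sqRep_factor_over _ _ hcz f hf c G ℓ hG hℓ1 hrep _ hs
    exact hasThreeBlocks_of_split hAB hA hB h6
  · -- generic case: `D = −c`, `Y² + c` irreducible over `ℚ`
    push Not at hsq
    have hD : Irreducible (X ^ 2 - C (-(c : ℚ)) : ℚ[X]) :=
      X_pow_sub_C_irreducible_of_prime Nat.prime_two hsq
    haveI : Fact (Irreducible (X ^ 2 - C (-(c : ℚ)) : ℚ[X])) := ⟨hD⟩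
    have hcz : CharZero (AdjoinRoot (X ^ 2 - C (-(c : ℚ)) : ℚ[X])) :=
      charZero_of_injective_algebraMap (algebraMap ℚ (AdjoinRoot (X ^ 2 - C (-(c : ℚ)) : ℚ[X]))).injective
    have hs : (AdjoinRoot.root (X ^ 2 - C (-(c : ℚ)) : ℚ[X])) ^ 2 =
        -(c : AdjoinRoot (X ^ 2 - C (-(c : ℚ)) : ℚ[X])) := by
      have h0 := AdjoinRoot.eval₂_root (X ^ 2 - C (-(c : ℚ)) : ℚ[X])
      rw [eval₂_sub, eval₂_pow, eval₂_X, eval₂_C, sub_eq_zero] at h0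
      rw [h0, (AdjoinRoot.of (X ^ 2 - C (-(c : ℚ)) : ℚ[X])).map_neg (c : ℚ),
        map_intCast (AdjoinRoot.of (X ^ 2 - C (-(c : ℚ)) : ℚ[X])) c]
    obtain ⟨A, B, hAB, hA, hB, h6⟩ := @sqRep_factor_over _ _ hcz f hf c G ℓ hG hℓ1 hrep _ hs
    exact hasThreeBlocks_of_split hAB hA hB h6

/-- PROVED (second, independent derivation of TODO-27's bound): for a non-degenerate square-class sextic,
`|Gal(f/ℚ)| ∣ 72` now also follows from the GENERIC 3-block bound `M23_threeBlocks_card_dvd` (p369982) through the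
linkage — the statement `M19_galois_card_dvd` of `SquareClassImprimitivity.lean` closed by a second route (the first is
`M19_galois_card_dvd_holds`, p367551). -/
theorem M19_card_dvd_72_of_threeBlocks :
    ∀ f : Sextic, NonDegenerate f → MemberSQ f → Nat.card (toRatPoly f).Gal ∣ 72 :=
  fun f hnd h => M23_threeBlocks_card_dvd f hnd (hasThreeBlocks_of_memberSQ hnd.1 h)

/-! ## Linkage 2 (TODO-29 (iii)): even after a rational shift ⇒ blocks of size 2 -/

/-- THE EVEN-AFTER-A-RATIONAL-SHIFT LOCUS (flag `EVEN` of rungs 20–23a; rung 23a's `CUBE` certificates satisfy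
`CUBE ⇔ EVEN` with `0` exceptions on `210 613` members, STRUCTURE.md §4 E38): `f(x) = g((x − t)²)` for a rational `t`
and a polynomial `g` of degree `≤ 3` over `ℚ` (for a genuine sextic `deg g = 3` is forced,
`natDegree_eq_three_of_evenAfterShift`). -/
def EvenAfterShift (f : Sextic) : Prop :=
  ∃ (t : ℚ) (g : ℚ[X]), g.natDegree ≤ 3 ∧ toRatPoly f = g.comp ((X - C t) ^ 2)

/-! ### The record's flag `EVEN` DECIDES `EvenAfterShift` (R302/R303, referee g40 remark R-2): the shift is forced,
`t = −a₅/(6a₆)`, and after it the predicate is «the odd part vanishes» — the test `rho22.even_after_shift` applies. -/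

/-- The `x⁵`-coefficient of `toPoly f` is `f 5`. -/
theorem coeff_toPoly_five (f : Sextic) : (toPoly f).coeff 5 = f 5 := by
  unfold toPoly; rw [finsetSum_coeff]; simp [Fin.sum_univ_seven]

/-- Coefficients of `toRatPoly f` are the integer coefficients. -/
theorem coeff_toRatPoly (f : Sextic) (n : ℕ) : (toRatPoly f).coeff n = (((toPoly f).coeff n : ℤ) : ℚ) := by
  rw [toRatPoly, coeff_map, eq_intCast]

/-- The two top coefficients of `g((x − t)²)` for `deg g ≤ 3`: `x⁶ ↦ g₃`, `x⁵ ↦ −6·t·g₃` (binomial theorem). -/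
theorem coeff_comp_shiftSq {t : ℚ} {g : ℚ[X]} (hg : g.natDegree ≤ 3) :
    (g.comp ((X - C t) ^ 2)).coeff 6 = g.coeff 3 ∧
      (g.comp ((X - C t) ^ 2)).coeff 5 = -6 * t * g.coeff 3 := by
  have hg4 : g.natDegree < 4 := by omega
  have hX : (X - C t : ℚ[X]) = X + C (-t) := by rw [C_neg, sub_eq_add_neg]
  have hexp : g.comp ((X - C t) ^ 2) = ∑ i ∈ Finset.range 4, C (g.coeff i) * (X + C (-t)) ^ (2 * i) := by
    conv_lhs => rw [g.as_sum_range_C_mul_X_pow' hg4]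
    rw [sum_comp]
    refine Finset.sum_congr rfl (fun i _ => ?_)
    rw [C_mul_comp, X_pow_comp, hX, ← pow_mul]
  have hc : ∀ k, (g.comp ((X - C t) ^ 2)).coeff k =
      ∑ i ∈ Finset.range 4, g.coeff i * ((-t) ^ (2 * i - k) * ((2 * i).choose k : ℚ)) := by
    intro k
    rw [hexp, finsetSum_coeff]
    refine Finset.sum_congr rfl (fun i _ => ?_)
    rw [coeff_C_mul, coeff_X_add_C_pow]
  exact ⟨by rw [hc]; simp [Finset.sum_range_succ, Nat.choose],
    by rw [hc]; simp [Finset.sum_range_succ, Nat.choose]; ring⟩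

/-- **PROVED: the shift is forced.** If `f(x) = g((x − t)²)` with `deg g ≤ 3` and `f 6 ≠ 0`, then `t = −f₅/(6f₆)`. -/
theorem evenShift_witness_eq {f : Sextic} (hf : f 6 ≠ 0) {t : ℚ} {g : ℚ[X]} (hg : g.natDegree ≤ 3)
    (hfg : toRatPoly f = g.comp ((X - C t) ^ 2)) : t = -((f 5 : ℚ) / (6 * (f 6 : ℚ))) := by
  obtain ⟨h6, h5⟩ := coeff_comp_shiftSq (t := t) hg
  rw [← hfg, coeff_toRatPoly, coeff_toPoly_six] at h6
  rw [← hfg, coeff_toRatPoly, coeff_toPoly_five] at h5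
  have hf6 : ((f 6 : ℤ) : ℚ) ≠ 0 := by exact_mod_cast hf
  rw [← h6] at h5
  field_simp
  linear_combination h5

/-- The shift of record `t₀(f) = −a₅/(6a₆)` (`rho22.even_after_shift`; res23 `CUBE` at `t = m/(2·lc)`). -/
def evenShift (f : Sextic) : ℚ := -((f 5 : ℚ) / (6 * (f 6 : ℚ)))

/-- Characteristic-free `Polynomial.expand_contract`: a polynomial supported on multiples of `p` is an expansion. -/
theorem expand_contract_of_coeff_eq_zero {R : Type*} [CommSemiring R] {p : ℕ} (hp : p ≠ 0) {q : R[X]}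
    (hq : ∀ n, ¬ p ∣ n → q.coeff n = 0) : expand R p (contract p q) = q := by
  ext n
  rw [coeff_expand (Nat.pos_of_ne_zero hp), coeff_contract hp]
  split_ifs with h
  · rw [Nat.div_mul_cancel h]
  · exact (hq n h).symm

/-- **PROVED (decision procedure for `EVEN`).** For a genuine sextic, `EvenAfterShift f` holds iff every odd
coefficient of `f(x + t₀)` vanishes, `t₀ = evenShift f = −a₅/(6a₆)` — exactly the record's test, so the flag `EVEN` of
rungs 20–23a COMPUTES the Lean predicate (the witness is `g = contract 2 (f(x + t₀))`). -/
theorem evenAfterShift_iff {f : Sextic} (hf : f 6 ≠ 0) :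
    EvenAfterShift f ↔ ∀ n, Odd n → (taylor (evenShift f) (toRatPoly f)).coeff n = 0 := by
  constructor
  · rintro ⟨t, g, hg, hfg⟩ n ⟨k, rfl⟩
    have ht : t = evenShift f := evenShift_witness_eq hf hg hfg
    have hT : taylor (evenShift f) (toRatPoly f) = expand ℚ 2 g := by
      rw [taylor_apply, hfg, ← ht, comp_assoc, pow_comp, sub_comp, X_comp, C_comp, add_sub_cancel_right,
        expand_eq_comp_X_pow]
    rw [hT, coeff_expand two_pos, if_neg (by omega)]
  · intro hodd
    set P := taylor (evenShift f) (toRatPoly f) with hP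
    have hPexp : expand ℚ 2 (contract 2 P) = P :=
      expand_contract_of_coeff_eq_zero two_ne_zero
        (fun n hn => hodd n (Nat.odd_iff.mpr (Nat.two_dvd_ne_zero.mp hn)))
    refine ⟨evenShift f, contract 2 P, ?_, ?_⟩
    · have hPdeg : P.natDegree = 6 := by rw [hP, natDegree_taylor, natDegree_toRatPoly hf]
      have h := natDegree_expand 2 (contract 2 P)
      rw [hPexp, hPdeg] at h
      omega
    · have h1 : toRatPoly f = taylor (-evenShift f) P := by
        rw [hP, taylor_taylor, neg_add_cancel, taylor_zero]
      rw [h1, taylor_apply]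
      conv_lhs => rw [← hPexp]
      rw [expand_eq_comp_X_pow, comp_assoc, X_pow_comp, C_neg, ← sub_eq_add_neg]

/-- Over a field, a polynomial that becomes a unit after composition with a non-constant polynomial is a unit. -/
theorem isUnit_of_isUnit_comp {F : Type*} [Field F] {a q : F[X]} (hq : 0 < q.natDegree)
    (hu : IsUnit (a.comp q)) : IsUnit a := by
  have h0 : (a.comp q).natDegree = 0 := natDegree_eq_zero_of_isUnit hu
  rw [natDegree_comp] at h0
  have ha : a.natDegree = 0 := by
    rcases Nat.mul_eq_zero.mp h0 with h | h
    · exact h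
    · omega
  rw [eq_C_of_natDegree_eq_zero ha] at hu ⊢
  rw [C_comp] at hu
  exact hu

/-- Over a field, if `p ∘ q` is irreducible for a non-constant `q`, then `p` is irreducible (a factorisation of `p`
composes to a factorisation of `p ∘ q`). [folklore] -/
theorem irreducible_of_irreducible_comp {F : Type*} [Field F] {p q : F[X]} (hq : 0 < q.natDegree)
    (h : Irreducible (p.comp q)) : Irreducible p := by
  refine irreducible_iff.mpr ⟨fun hu => ?_, fun a b hab => ?_⟩
  · have hpc := eq_C_of_natDegree_eq_zero (natDegree_eq_zero_of_isUnit hu)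
    refine h.not_isUnit ?_
    rw [hpc, C_comp]
    rw [hpc] at hu
    exact hu
  · have hfac : p.comp q = a.comp q * b.comp q := by rw [hab, mul_comp]
    rcases h.isUnit_or_isUnit hfac with hu | hu
    · exact Or.inl (isUnit_of_isUnit_comp hq hu)
    · exact Or.inr (isUnit_of_isUnit_comp hq hu)

/-- The shift square `(x − t)²` has degree `2`. -/
theorem natDegree_shiftSq {F : Type*} [Field F] (t : F) : ((X - C t) ^ 2 : F[X]).natDegree = 2 := by
  rw [natDegree_pow, natDegree_X_sub_C]

/-- The quadratic factor `(x − a)² − θ` has degree `2`. -/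
theorem natDegree_shiftSq_sub_C {F : Type*} [Field F] (a θ : F) : ((X - C a) ^ 2 - C θ : F[X]).natDegree = 2 := by
  rw [natDegree_sub_C, natDegree_shiftSq]

/-- For a genuine sextic the inner polynomial of an even-after-shift representation has degree exactly `3`. -/
theorem natDegree_eq_three_of_evenAfterShift {f : Sextic} (hf : f 6 ≠ 0) {t : ℚ} {g : ℚ[X]}
    (hfg : toRatPoly f = g.comp ((X - C t) ^ 2)) : g.natDegree = 3 := by
  have h6 := natDegree_toRatPoly hf
  rw [hfg, natDegree_comp, natDegree_shiftSq] at h6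
  omega

/-- DEGENERATE CASE (PROVED): if the inner cubic `g` is reducible over `ℚ`, so is `f` — such `EVEN` sextics lie in the
part `RED` of the classified residual, not in its irreducible 5-cycle-free component (rung 20 / M-20 bookkeeping). -/
theorem not_irreducible_of_evenAfterShift_reducible {f : Sextic} {t : ℚ} {g : ℚ[X]}
    (hfg : toRatPoly f = g.comp ((X - C t) ^ 2)) (hg : ¬ Irreducible g) : ¬ Irreducible (toRatPoly f) := by
  intro hirr
  rw [hfg] at hirr
  exact hg (irreducible_of_irreducible_comp (by rw [natDegree_shiftSq]; norm_num) hirr)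

/-- **PROVED (TODO-29 linkage, EVEN ⊆ 2-blocks).** An IRREDUCIBLE non-degenerate sextic that is even after a rational
shift, `f(x) = g((x − t)²)`, has blocks of size `2`: `g` is an irreducible cubic (irreducibility descends through the
composition), and over the cubic field `L = ℚ[Y]/(g)` with root `θ`, `g(Y) = (Y − θ)·g₁(Y)` gives
`f(x) = ((x − t)² − θ) · g₁((x − t)²)` — a quadratic factor over `L`. This is the degenerate sub-case `S̃ = (Y − m)³`,
`m = 2t·lc` (all three root-pair sums equal `2t`; res23's `CUBE`), of rung 23a's Galois-stable pairing `r ↦ 2t − r`. -/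
theorem hasTwoBlocks_of_evenAfterShift {f : Sextic} (hnd : NonDegenerate f) (hirr : Irreducible (toRatPoly f))
    (h : EvenAfterShift f) : HasTwoBlocks f := by
  obtain ⟨t, g, -, hfg⟩ := h
  have hg3 : g.natDegree = 3 := natDegree_eq_three_of_evenAfterShift hnd.1 hfg
  have hgirr : Irreducible g := by
    rw [hfg] at hirr
    exact irreducible_of_irreducible_comp (by rw [natDegree_shiftSq]; norm_num) hirr
  haveI : Fact (Irreducible g) := ⟨hgirr⟩
  -- the cubic field `L = ℚ[Y]/(g)` (= `AdjoinRoot g`), its root `θ = AdjoinRoot.root g`, and `g = (Y − θ)·g₁` over `L`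
  have hroot : IsRoot (g.map (algebraMap ℚ (AdjoinRoot g))) (AdjoinRoot.root g) := AdjoinRoot.isRoot_root g
  obtain ⟨g₁, hg₁⟩ : ∃ g₁ : (AdjoinRoot g)[X],
      g.map (algebraMap ℚ (AdjoinRoot g)) = (X - C (AdjoinRoot.root g)) * g₁ :=
    ⟨_, (mul_divByMonic_eq_iff_isRoot.mpr hroot).symm⟩
  have hq2 : ((X - C (algebraMap ℚ (AdjoinRoot g) t)) ^ 2 - C (AdjoinRoot.root g)).natDegree = 2 :=
    natDegree_shiftSq_sub_C _ _
  have hfin : (toRatPoly f).map (algebraMap ℚ (AdjoinRoot g)) =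
      ((X - C (algebraMap ℚ (AdjoinRoot g) t)) ^ 2 - C (AdjoinRoot.root g)) *
        g₁.comp ((X - C (algebraMap ℚ (AdjoinRoot g) t)) ^ 2) := by
    rw [hfg, map_comp, Polynomial.map_pow, Polynomial.map_sub, map_X, map_C, hg₁, mul_comp, sub_comp, X_comp,
      C_comp]
  unfold HasTwoBlocks
  exact ⟨g, hg3, hgirr, _, _, hq2, hfin⟩

/-- PROVED corollary: an irreducible non-degenerate even-after-shift sextic has `|Gal(f/ℚ)| ∣ 144` (p369982's 2-block
bound; the sharp `48 = |C₂ ≀ S₃|` for irreducible 2-block sextics is owed) … -/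
theorem evenAfterShift_card_dvd {f : Sextic} (hnd : NonDegenerate f) (hirr : Irreducible (toRatPoly f))
    (h : EvenAfterShift f) : Nat.card (toRatPoly f).Gal ∣ 144 :=
  M23_twoBlocks_card_dvd f hnd (hasTwoBlocks_of_evenAfterShift hnd hirr h)

/-- … hence is never `Typical`, … -/
theorem evenAfterShift_not_typical {f : Sextic} (hnd : NonDegenerate f) (hirr : Irreducible (toRatPoly f))
    (h : EvenAfterShift f) : ¬ Typical f :=
  M23_not_typical f hnd (Or.inr (hasTwoBlocks_of_evenAfterShift hnd hirr h))

/-- … and its Galois group has no element of order `5` (no `(5,1)` Frobenius pattern — the rung-18 residual mechanism). -/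
theorem evenAfterShift_orderOf_ne_five {f : Sextic} (hnd : NonDegenerate f) (hirr : Irreducible (toRatPoly f))
    (h : EvenAfterShift f) (σ : (toRatPoly f).Gal) : orderOf σ ≠ 5 :=
  M23_orderOf_ne_five hnd (Or.inr (hasTwoBlocks_of_evenAfterShift hnd hirr h)) σ

/-! ## Linkage 3 (M-20): a REDUCIBLE sextic is never typical -/

/-- **PROVED (mechanism M-20, the part `RED` of the classified residual).** A non-degenerate sextic that is REDUCIBLE
over `ℚ` is never `Typical`: a nontrivial factorisation `f = a·b` with `deg a = d ∈ {1,…,5}` gives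
`|Gal(f/ℚ)| ∣ d!·(6 − d)! ≤ 120 < 360` (`card_gal_mul_dvd`, `card_gal_dvd_factorial`, p367551). Rung 20 found the
residual at height `24` to be `74.4 %` reducible over `ℚ` (M-20); this is the typed reason none of those members is
certificate-typical. Together with `evenAfterShift_not_typical` it covers the whole `EVEN` locus. -/
theorem not_typical_of_reducible {f : Sextic} (hnd : NonDegenerate f) (hred : ¬ Irreducible (toRatPoly f)) :
    ¬ Typical f := by
  classical
  intro htyp
  unfold Typical at htyp
  have hF6 : (toRatPoly f).natDegree = 6 := natDegree_toRatPoly hnd.1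
  have hF0 : toRatPoly f ≠ 0 := by
    intro h0
    rw [h0, natDegree_zero] at hF6
    omega
  have hFu : ¬ IsUnit (toRatPoly f) := by
    intro hu
    have := natDegree_eq_zero_of_isUnit hu
    omega
  -- a nontrivial factorisation
  have hfac : ∃ a b : ℚ[X], toRatPoly f = a * b ∧ ¬ IsUnit a ∧ ¬ IsUnit b := by
    by_contra hno
    push Not at hno
    exact hred (irreducible_iff.mpr ⟨hFu, fun a b hab => by
      by_cases ha : IsUnit a
      · exact Or.inl ha
      · exact Or.inr (hno a b hab ha)⟩)
  obtain ⟨a, b, hab, hau, hbu⟩ := hfac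
  have hab0 : a * b ≠ 0 := hab ▸ hF0
  have ha0 : a ≠ 0 := left_ne_zero_of_mul hab0
  have hb0 : b ≠ 0 := right_ne_zero_of_mul hab0
  have hda : 0 < a.natDegree := natDegree_pos_iff_degree_pos.mpr (degree_pos_of_ne_zero_of_nonunit ha0 hau)
  have hdb : 0 < b.natDegree := natDegree_pos_iff_degree_pos.mpr (degree_pos_of_ne_zero_of_nonunit hb0 hbu)
  have hsum : a.natDegree + b.natDegree = 6 := by rw [← natDegree_mul ha0 hb0, ← hab, hF6]
  have hdvd : Nat.card (toRatPoly f).Gal ∣ (a.natDegree).factorial * (b.natDegree).factorial := by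
    rw [hab]
    exact (card_gal_mul_dvd a b).trans (mul_dvd_mul (card_gal_dvd_factorial a) (card_gal_dvd_factorial b))
  have hle : (a.natDegree).factorial * (b.natDegree).factorial ≤ 120 := by
    obtain ⟨m, hm⟩ : ∃ m, a.natDegree = m + 1 := ⟨a.natDegree - 1, by omega⟩
    have hb' : b.natDegree = 5 - m := by omega
    rw [hm, hb']
    have hm4 : m ≤ 4 := by omega
    interval_cases m <;> decide
  have := Nat.le_of_dvd (Nat.mul_pos (Nat.factorial_pos _) (Nat.factorial_pos _)) hdvd
  omega

/-- PROVED (the `EVEN` locus in one statement): a non-degenerate even-after-shift sextic is never `Typical`, whether or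
not it is irreducible over `ℚ`. -/
theorem evenAfterShift_not_typical' {f : Sextic} (hnd : NonDegenerate f) (h : EvenAfterShift f) : ¬ Typical f := by
  by_cases hirr : Irreducible (toRatPoly f)
  · exact evenAfterShift_not_typical hnd hirr h
  · exact not_typical_of_reducible hnd hirr

end Summit.Ventures.ResidMod.Conjectures
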